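/- Lead seat `ym-line-cbag-p1` (prover-ym-line-cbag-p1-g18-0) of the sibling line `ColdBoxAllGroups` (planner-of-record ym-idea-2; own crux
`BoxFloorAllGroups` stmt-QuantumFields-22254 CLOSED): torus → box-kernel DLR plumbing for EVERY plaquette pair, glue for crux `DensityTransferG`
(stmt-QuantumFields-25709) of route `SixPlaneColdBox`.  RECORD-type material; the Yang–Mills mass gap is NOT proved by anything here. -/
import Summits.QuantumFields.YangMills.Theorems.ColdBoxAllGroupsBulkAllGroupsDlrPlumbingG

/-!
# Route `SixPlaneColdBox`, crux `DensityTransferG`: the torus pair covariances through the box kernels (every plaquette pair)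

The engine of `BulkAllGroups` reads the torus two-point function of the `(1,2)`-plaquette cost through the DLR box kernels
(`ColdBoxAllGroups.torusPlaqCov_eq_boxKernelG`: translation invariance of the torus Wilson state + the DLR equations for cylinder observables
whose support fits in the torus).  Crux `DensityTransferG` (stmt-QuantumFields-25709) runs that engine for ALL 36 plane pairs of the
six-plane action density; with the torus dictionary `SixPlaneColdBox.latticeConnectedCorr_actionDensity_eq_sum_pairs_of_rep`
(`Theorems/SixPlaneColdBoxTorusDensityPairs.lean`: the six-plane connected correlator is the sum of the 36 pair correlators
`latticeConnectedCorr ρ β (L+1) (plaqCost0 ρ q) (plaqCost0 ρ q') T`) the torus side of the transfer needs exactly the per-pair identity proved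
here:

* `fst_mem_box_of_mem_boxUnion_pair` — torus fit: every edge of the box `Λ = boxEdges 4 (2H+1)`, of its collar, and of the two plaquettes
  `(boxCentre H; q)`, `(boxCentre H + Te₀; q')` is based in `[−M, M]⁴`, `M = 2H + T + 2` (any planes `q, q'`);
* `latticeConnectedCorr_pair_eq_boxKernelG` — for the torus of side `L+1 > 2(2H+T+2)`, every compact `G`, continuous unitary `ρ`
  (second-countable `G`) and all planes `q, q'`:
  `latticeConnectedCorr ρ β (L+1) (plaqCost0 ρ q) (plaqCost0 ρ q') T = ∫ K[c_P c_{P'}] − ∫ K[c_P] · ∫ K[c_{P'}]`, where `K[·]` is the box-kernel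
  mean `∫ · ∂(ymSpecification ρ β Λ (torusLift (L+1) U))` integrated over the torus Wilson state, `P = (boxCentre H; q)`,
  `P' = (boxCentre H + Te₀; q')` (Georgii 2011 Thm. 4.17; Friedli–Velenik 2017 Lemma 6.7) — the `G`- and plane-generic port of
  `torusPlaqCov_eq_boxKernelG`;
* `latticeConnectedCorr_pair_eq_boxKernel_of_rep` — the same for every faithful unitary lattice representation `r` (binder shape of the route).

Plumbing only; no estimate.  No sorry; standard axioms.  NOT the Yang–Mills mass gap; no item is proved here.
-/

set_option autoImplicit false

noncomputable section

open MeasureTheory Filter Topology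
open Literature.MathematicalPhysics
open Literature.MathematicalPhysics.QuantumFieldTheory
open Literature.MathematicalPhysics.QuantumLattice
open Literature.Probability.LatticeModels (Torus.proj box mem_box)
open Summit.QuantumFields.YangMills.Theorems.WeakCouplingRates

namespace Summit.QuantumFields.YangMills.Theorems.SixPlaneColdBox

/-! ### Torus fit for a general plaquette pair -/

/-- **Torus fit (any planes).** Every edge of the box `Λ = boxEdges 4 (2H+1)`, of its collar, and of the two plaquettes `(boxCentre H; q)`,
`(boxCentre H + Te₀; q')` is based in `[−M, M]⁴`, `M = 2H + T + 2`. -/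
theorem fst_mem_box_of_mem_boxUnion_pair {H T : ℕ} (q q' : {q : Fin 4 × Fin 4 // q.1 < q.2}) {e : QuantumLattice.ZdEdge 4}
    (he : e ∈ AxialGauge.boxEdges 4 (2 * H + 1) ∪
        (plaquetteEdges ((boxCentre H, q) : ZdPlaquette 4) ∪
          plaquetteEdges ((boxCentre H + Pi.single 0 (T : ℤ), q') : ZdPlaquette 4)) ∪
        (plaquettesTouching (AxialGauge.boxEdges 4 (2 * H + 1))).biUnion plaquetteEdges) :
    e.1 ∈ box 4 (2 * H + T + 2) := by
  rw [mem_box]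
  intro k
  have hM : ((2 * H + T + 2 : ℕ) : ℤ) = 2 * (H : ℤ) + T + 2 := by push_cast; ring
  rw [hM]
  rcases Finset.mem_union.1 he with he | he
  · rcases Finset.mem_union.1 he with he | he
    · obtain ⟨x, i⟩ := e
      have h := (AxialGauge.mem_boxEdges_iff.1 he).1 k
      simp only
      constructor <;> push_cast at h <;> omega
    · rcases Finset.mem_union.1 he with he | he
      · have h := coord_of_mem_plaquetteEdges he k
        simp only [boxCentre] at h
        constructor <;> omega
      · have h := coord_of_mem_plaquetteEdges he k
        simp only [boxCentre, Pi.add_apply, Pi.single_apply] at h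
        split_ifs at h <;> constructor <;> omega
  · obtain ⟨e', he', hn⟩ := exists_near_of_mem_collar he
    obtain ⟨x, i⟩ := e'
    have h := (AxialGauge.mem_boxEdges_iff.1 he').1 k
    have hk := hn k
    simp only at hk
    constructor <;> push_cast at h <;> omega

/-! ### The torus pair covariance through the box kernels -/

section Torus

variable {N : ℕ} {G : Type} [Group G] [TopologicalSpace G] [IsTopologicalGroup G] [CompactSpace G]
  [MeasurableSpace G] [BorelSpace G]
variable (ρ : G →* Matrix (Fin N) (Fin N) ℂ)

omit [TopologicalSpace G] [IsTopologicalGroup G] [CompactSpace G] [MeasurableSpace G] [BorelSpace G] in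
/-- The plaquette cost `plaqCostAt ρ x q` is a cylinder observable on the four edges of the plaquette `(x; q)` (any plane). -/
theorem isCylinder_plaqCostAt_pairG (x : Literature.Probability.LatticeModels.Site 4) (q : {q : Fin 4 × Fin 4 // q.1 < q.2}) :
    IsCylinder (plaqCostAt ρ x q.1.1 q.1.2) (plaquetteEdges ((x, q) : ZdPlaquette 4)) := by
  intro U V hUV
  have h := isCylinder_plaquetteObs (G := G) ρ ((x, q) : ZdPlaquette 4) hUV
  simp only [plaqCostAt]
  exact congrArg (fun r : ℝ => (N : ℝ) - r) h

/-- **The torus pair covariance through the box kernels, every compact `G` and every pair of planes.**  For the torus of side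
`L+1 > 2(2H+T+2)`, the torus connected correlator `latticeConnectedCorr ρ β (L+1) (plaqCost0 ρ q) (plaqCost0 ρ q') T` of the `q`-plaquette
cost at the origin and the `q'`-plaquette cost translated by `T e₀` equals `∫ K[c_P c_{P'}] − ∫ K[c_P] · ∫ K[c_{P'}]`, where `K[·]` denotes the
box-kernel mean `∫ · ∂(ymSpecification ρ β (boxEdges 4 (2H+1)) (torusLift (L+1) U))` integrated over the torus Wilson state and
`P = (boxCentre H; q)`, `P' = (boxCentre H + Te₀; q')` (translation invariance + DLR; Georgii 2011 Thm. 4.17, Friedli–Velenik 2017 Lemma 6.7).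
The plane-generic port of `ColdBoxAllGroups.torusPlaqCov_eq_boxKernelG`.  Plumbing only; NOT the Clay gap. -/
theorem latticeConnectedCorr_pair_eq_boxKernelG [SecondCountableTopology G] (hρ : Continuous ρ)
    (hρu : ∀ g, ρ g ∈ Matrix.unitaryGroup (Fin N) ℂ) (β : ℝ) {H T L : ℕ} (hL : 2 * (2 * H + T + 2) < L + 1)
    (q q' : {q : Fin 4 × Fin 4 // q.1 < q.2}) :
    latticeConnectedCorr ρ β (L + 1) (plaqCost0 ρ q.1.1 q.1.2) (plaqCost0 ρ q'.1.1 q'.1.2) T =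
      (∫ U, (∫ W, plaqCostAt ρ (boxCentre H) q.1.1 q.1.2 W * plaqCostAt ρ (boxCentre H + Pi.single 0 (T : ℤ)) q'.1.1 q'.1.2 W
            ∂(ymSpecification (d := 4) ρ β (AxialGauge.boxEdges 4 (2 * H + 1)) (torusLift (L + 1) U)))
          ∂(wilsonMeasure (d := 4) (L := L + 1) ρ β)) -
        (∫ U, (∫ W, plaqCostAt ρ (boxCentre H) q.1.1 q.1.2 W
            ∂(ymSpecification (d := 4) ρ β (AxialGauge.boxEdges 4 (2 * H + 1)) (torusLift (L + 1) U)))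
          ∂(wilsonMeasure (d := 4) (L := L + 1) ρ β)) *
        (∫ U, (∫ W, plaqCostAt ρ (boxCentre H + Pi.single 0 (T : ℤ)) q'.1.1 q'.1.2 W
            ∂(ymSpecification (d := 4) ρ β (AxialGauge.boxEdges 4 (2 * H + 1)) (torusLift (L + 1) U)))
          ∂(wilsonMeasure (d := 4) (L := L + 1) ρ β)) := by
  set bc : Literature.Probability.LatticeModels.Site 4 := boxCentre H with hbc
  set v0 : Literature.Probability.LatticeModels.Site 4 := Pi.single 0 (T : ℤ) with hv0
  set Λ : Finset (QuantumLattice.ZdEdge 4) := AxialGauge.boxEdges 4 (2 * H + 1) with hΛ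
  set cp : LGConfig 4 G → ℝ := plaqCostAt ρ bc q.1.1 q.1.2 with hcp
  set cp' : LGConfig 4 G → ℝ := plaqCostAt ρ (bc + v0) q'.1.1 q'.1.2 with hcp'
  -- supports and the torus fit
  set S₀ : Finset (QuantumLattice.ZdEdge 4) :=
    plaquetteEdges ((bc, q) : ZdPlaquette 4) ∪ plaquetteEdges ((bc + v0, q') : ZdPlaquette 4) with hS₀
  have hcyl : IsCylinder cp S₀ := (isCylinder_plaqCostAt_pairG ρ bc q).mono (Finset.coe_subset.2 Finset.subset_union_left)
  have hcyl' : IsCylinder cp' S₀ := (isCylinder_plaqCostAt_pairG ρ (bc + v0) q').mono (Finset.coe_subset.2 Finset.subset_union_right)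
  have hcylq : IsCylinder (fun U => cp U * cp' U) S₀ :=
    IsCylinder.mul (isCylinder_plaqCostAt_pairG ρ bc q) (isCylinder_plaqCostAt_pairG ρ (bc + v0) q')
  have hinj : Set.InjOn (Torus.proj (L + 1))
      ((Λ ∪ S₀ ∪ (plaquettesTouching Λ).biUnion plaquetteEdges).image Prod.fst :
        Set (Literature.Probability.LatticeModels.Site 4)) := by
    intro x hx y hy hxy
    obtain ⟨e, he, rfl⟩ := Finset.mem_image.1 (Finset.mem_coe.1 hx)
    obtain ⟨e', he', rfl⟩ := Finset.mem_image.1 (Finset.mem_coe.1 hy)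
    exact Literature.Probability.LatticeModels.torusProj_injOn_box hL (fst_mem_box_of_mem_boxUnion_pair q q' he)
      (fst_mem_box_of_mem_boxUnion_pair q q' he') hxy
  -- continuity and bounds of the three observables
  have hcpc : Continuous cp := ColdBoxAllGroups.continuous_plaqCostAtG ρ hρ bc q.1.1 q.1.2
  have hcpc' : Continuous cp' := ColdBoxAllGroups.continuous_plaqCostAtG ρ hρ (bc + v0) q'.1.1 q'.1.2
  have hcpK : ∀ U, |cp U| ≤ 2 * N := ColdBoxAllGroups.abs_plaqCostAt_leG ρ hρu bc q.1.1 q.1.2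
  have hcpK' : ∀ U, |cp' U| ≤ 2 * N := ColdBoxAllGroups.abs_plaqCostAt_leG ρ hρu (bc + v0) q'.1.1 q'.1.2
  have hqc : Continuous fun U => cp U * cp' U := hcpc.mul hcpc'
  have hqK : ∀ U, |cp U * cp' U| ≤ 2 * N * (2 * N) := fun U => by
    rw [abs_mul]; exact mul_le_mul (hcpK U) (hcpK' U) (abs_nonneg _) (by positivity)
  -- the DLR equations for cylinder observables on `S₀`
  have dlr : ∀ {F : LGConfig 4 G → ℝ}, Continuous F → ∀ {C : ℝ}, (∀ U, |F U| ≤ C) → IsCylinder F S₀ →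
      ∫ U, F (torusLift (L + 1) U) ∂(wilsonMeasure (d := 4) (L := L + 1) ρ β) =
        ∫ U, (∫ W, F W ∂(ymSpecification ρ β Λ (torusLift (L + 1) U))) ∂(wilsonMeasure (d := 4) (L := L + 1) ρ β) := by
    intro F hF C hC hFS
    have h := wilsonExpectation_toTorusObservable_eq ρ hρ β Λ hF hC hFS (L := L + 1) hinj
    simpa only [wilsonExpectation, toTorusObservable, Function.comp_def] using h
  -- translation of the origin-based pair to the box centre
  have hpt1 : ∀ W : LGConfig 4 G, cp (configShift bc W) = plaqCost0 ρ q.1.1 q.1.2 W := fun W => by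
    simp only [hcp, plaqCostAt, plaqCost0, plaquetteObs, plaquetteHolonomyZd_configShift, sub_self]
  have hpt2 : ∀ W : LGConfig 4 G, cp' (configShift bc W) = plaqCost0 ρ q'.1.1 q'.1.2 (configShift (-Pi.single 0 (T : ℤ)) W) :=
    fun W => by
    simp only [hcp', plaqCostAt, plaqCost0, plaquetteObs, plaquetteHolonomyZd_configShift, hv0, add_sub_cancel_left,
      sub_neg_eq_add, zero_add]
  have hpt3 : ∀ W : LGConfig 4 G, cp' (configShift (bc + v0) W) = plaqCost0 ρ q'.1.1 q'.1.2 W := fun W => by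
    simp only [hcp', plaqCostAt, plaqCost0, plaquetteObs, plaquetteHolonomyZd_configShift, sub_self]
  have e1 : ∫ U, plaqCost0 ρ q.1.1 q.1.2 (torusLift (L + 1) U) *
        plaqCost0 ρ q'.1.1 q'.1.2 (configShift (-Pi.single 0 (T : ℤ)) (torusLift (L + 1) U)) ∂(wilsonMeasure (d := 4) (L := L + 1) ρ β) =
      ∫ U, (∫ W, cp W * cp' W ∂(ymSpecification ρ β Λ (torusLift (L + 1) U))) ∂(wilsonMeasure (d := 4) (L := L + 1) ρ β) := by
    rw [← dlr hqc hqK hcylq, ← integral_comp_configShift_torusLift (S := L + 1) ρ β (fun U => cp U * cp' U) bc]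
    simp only [hpt1, hpt2]
  have e2 : ∫ U, plaqCost0 ρ q.1.1 q.1.2 (torusLift (L + 1) U) ∂(wilsonMeasure (d := 4) (L := L + 1) ρ β) =
      ∫ U, (∫ W, cp W ∂(ymSpecification ρ β Λ (torusLift (L + 1) U))) ∂(wilsonMeasure (d := 4) (L := L + 1) ρ β) := by
    rw [← dlr hcpc hcpK hcyl, ← integral_comp_configShift_torusLift (S := L + 1) ρ β cp bc]
    simp only [hpt1]
  have e3 : ∫ U, plaqCost0 ρ q'.1.1 q'.1.2 (torusLift (L + 1) U) ∂(wilsonMeasure (d := 4) (L := L + 1) ρ β) =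
      ∫ U, (∫ W, cp' W ∂(ymSpecification ρ β Λ (torusLift (L + 1) U))) ∂(wilsonMeasure (d := 4) (L := L + 1) ρ β) := by
    rw [← dlr hcpc' hcpK' hcyl', ← integral_comp_configShift_torusLift (S := L + 1) ρ β cp' (bc + v0)]
    simp only [hpt3]
  unfold latticeConnectedCorr
  rw [e1, e2, e3]

end Torus

/-! ### The binder shape of the route: every faithful unitary lattice representation -/

/-- **The pair DLR identity for every compact `G` and every faithful unitary lattice representation `r`** (Borel structure `borel G`; second
countability from the closed embedding `r.ρ`): for `L+1 > 2(2H+T+2)` and all planes `q, q'`,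
`latticeConnectedCorr r.ρ β (L+1) (plaqCost0 r.ρ q) (plaqCost0 r.ρ q') T = ∫ K[c_P c_{P'}] − ∫ K[c_P] · ∫ K[c_{P'}]` with the box-kernel means at
`P = (boxCentre H; q)`, `P' = (boxCentre H + Te₀; q')`.  Combined with `latticeConnectedCorr_actionDensity_eq_sum_pairs_of_rep` this is the torus side
of crux `DensityTransferG` for the six-plane density.  NOT the Clay gap. -/
theorem latticeConnectedCorr_pair_eq_boxKernel_of_rep :
    ∀ (G : Type) [Group G] [TopologicalSpace G] [IsTopologicalGroup G] [CompactSpace G],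
    letI : MeasurableSpace G := borel G
    haveI : BorelSpace G := ⟨rfl⟩
    ∀ (r : LatticeRep G) (β : ℝ) {H T L : ℕ}, 2 * (2 * H + T + 2) < L + 1 → ∀ q q' : {q : Fin 4 × Fin 4 // q.1 < q.2},
      latticeConnectedCorr r.ρ β (L + 1) (plaqCost0 r.ρ q.1.1 q.1.2) (plaqCost0 r.ρ q'.1.1 q'.1.2) T =
        (∫ U, (∫ W, plaqCostAt r.ρ (boxCentre H) q.1.1 q.1.2 W * plaqCostAt r.ρ (boxCentre H + Pi.single 0 (T : ℤ)) q'.1.1 q'.1.2 W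
              ∂(ymSpecification (d := 4) r.ρ β (AxialGauge.boxEdges 4 (2 * H + 1)) (torusLift (L + 1) U)))
            ∂(wilsonMeasure (d := 4) (L := L + 1) r.ρ β)) -
          (∫ U, (∫ W, plaqCostAt r.ρ (boxCentre H) q.1.1 q.1.2 W
              ∂(ymSpecification (d := 4) r.ρ β (AxialGauge.boxEdges 4 (2 * H + 1)) (torusLift (L + 1) U)))
            ∂(wilsonMeasure (d := 4) (L := L + 1) r.ρ β)) *
          (∫ U, (∫ W, plaqCostAt r.ρ (boxCentre H + Pi.single 0 (T : ℤ)) q'.1.1 q'.1.2 W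
              ∂(ymSpecification (d := 4) r.ρ β (AxialGauge.boxEdges 4 (2 * H + 1)) (torusLift (L + 1) U)))
            ∂(wilsonMeasure (d := 4) (L := L + 1) r.ρ β)) := by
  intro G _ _ _ _
  letI : MeasurableSpace G := borel G
  haveI : BorelSpace G := ⟨rfl⟩
  intro r β H T L hL q q'
  haveI : SecondCountableTopology G :=
    (r.continuous.isClosedEmbedding r.injective).isEmbedding.secondCountableTopology
  exact latticeConnectedCorr_pair_eq_boxKernelG r.ρ r.continuous r.mem_unitary β hL q q'

end Summit.QuantumFields.YangMills.Theorems.SixPlaneColdBox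

end
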